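import Summits.KontsevichZagierPeriods.Zeta5Search.LaiSweepShard

/-!
# `κ₃` sweep certificate — shard file 113 of 127 (shards 791–797 of 889)

HONEST FRAMING. Systematic search; no irrationality claim unless certified. This file only checks,
by `decide +kernel`, shards 791–797 of the order-cell sweep of the `κ₃` point `(74, 2180, 444; δ74)`
(engine `LaiSweepEngine`, soundness `LaiSweepJump/Free/Eval/Shard/Kappa3`; a shard is `⟨regime, n,
p, q, p', q', Lo, Up⟩`: `n` cells from `p/q` to `p'/q'` with integer rate sums in `[Lo, Up]`, `K =
128`, `D = 2^40`). It draws NO conclusion: only the capstone `LaiKappa3SweepCert`, which needs all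
127 shard files, does. Kernel cost of this file ≈ 560 cells × 0.3 s.
-/

namespace Summit.KontsevichZagierPeriods.Zeta5Search.Sweep

set_option maxHeartbeats 100000000 in
/-- Shard 791: 80 cells of regime B from `293/334` to `253/288`.
[cite: Lai2024BallRivoal, §4 Lemma 4.3] -/
theorem shard791 :
    Shard.check 128 (2^40)
      ⟨true, 80, 293, 334, 253, 288, 10340660875909, 17152030192963⟩ = true := by
  decide +kernel

set_option maxHeartbeats 100000000 in
/-- Shard 792: 80 cells of regime B from `253/288` to `256/291`.
[cite: Lai2024BallRivoal, §4 Lemma 4.3] -/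
theorem shard792 :
    Shard.check 128 (2^40)
      ⟨true, 80, 253, 288, 256, 291, 10557021999405, 17528898009878⟩ = true := by
  decide +kernel

set_option maxHeartbeats 100000000 in
/-- Shard 793: 80 cells of regime B from `256/291` to `311/353`.
[cite: Lai2024BallRivoal, §4 Lemma 4.3] -/
theorem shard793 :
    Shard.check 128 (2^40)
      ⟨true, 80, 256, 291, 311, 353, 10900690224476, 18118661686845⟩ = true := by
  decide +kernel

set_option maxHeartbeats 100000000 in
/-- Shard 794: 80 cells of regime B from `311/353` to `322/365`.
[cite: Lai2024BallRivoal, §4 Lemma 4.3] -/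
theorem shard794 :
    Shard.check 128 (2^40)
      ⟨true, 80, 311, 353, 322, 365, 9859612396993, 16404870160144⟩ = true := by
  decide +kernel

set_option maxHeartbeats 100000000 in
/-- Shard 795: 80 cells of regime B from `322/365` to `220/249`.
[cite: Lai2024BallRivoal, §4 Lemma 4.3] -/
theorem shard795 :
    Shard.check 128 (2^40)
      ⟨true, 80, 322, 365, 220, 249, 11281467479800, 18790292295816⟩ = true := by
  decide +kernel

set_option maxHeartbeats 100000000 in
/-- Shard 796: 80 cells of regime B from `220/249` to `192/217`.
[cite: Lai2024BallRivoal, §4 Lemma 4.3] -/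
theorem shard796 :
    Shard.check 128 (2^40)
      ⟨true, 80, 220, 249, 192, 217, 10574251826645, 17631239906379⟩ = true := by
  decide +kernel

set_option maxHeartbeats 100000000 in
/-- Shard 797: 80 cells of regime B from `192/217` to `241/272`.
[cite: Lai2024BallRivoal, §4 Lemma 4.3] -/
theorem shard797 :
    Shard.check 128 (2^40)
      ⟨true, 80, 192, 217, 241, 272, 10380211599638, 17325527679992⟩ = true := by
  decide +kernel

/-- The checked shards of this file, in order. [folklore] -/
def shards113 : List (CheckedShard 128 (2^40)) :=
  [⟨_, shard791⟩, ⟨_, shard792⟩, ⟨_, shard793⟩, ⟨_, shard794⟩, ⟨_, shard795⟩,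
    ⟨_, shard796⟩, ⟨_, shard797⟩]

end Summit.KontsevichZagierPeriods.Zeta5Search.Sweep
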